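import Literature.NumberTheory.LFunctions.Zhang2022.Section8ProfileSjMain
import HarnessLib

/-!
# Zhang (2022) §8 for profile data, BILINEAR version: the product profile `Φ(z) = jetEx(u)(z)·massEx(v̄)(z)` of TWO
# short pieces `u` (ψ-side, length `θ_u`) and `v` (anti-side, length `θ_v`), its calculus on `[0, θ₀]`,
# `θ₀ ≤ min(θ_u, θ_v)`, the (8.10) collapse and the jets dictionary `Φ ↔ 𝔧_j(u)·𝔪(bS j, bN j; v̄)`

Topic `Literature/NumberTheory/LFunctions/Zhang2022` (Landau–Siegel audit tree; verdict-neutral). Y. Zhang, *Discrete mean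
estimates and the Landau–Siegel zero*, arXiv:2211.02515v1 (2022) [Zhang2022LandauSiegel] — **an unrefereed manuscript
under adjudication; nothing here asserts or denies its Theorems 1–2; no claim about Landau–Siegel zeros.** Cell
landau-siegel §D, crux K0 = stmt-Parity-20459 `InClassSideTablesPiece` (line «sjrows»), prover ls-knife-K0-p1 g3.

WHY A BILINEAR VERSION. Prop 7.1's arithmetic sum `S_j(𝐚₁, 𝐚₂)` is bilinear in its two coefficient tables. The landed row
(S) (`Section8ProfileSjRow.sjProfileRow_C2`, `Section8ProfileSjPoly`) evaluates the DIAGONAL `S_j(𝐚_u, conj 𝐚_u)` for one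
`C²` short piece `u`. A KINKED in-class piece (continuous, piecewise `C²`, finitely many interior kinks) is a finite sum
`u = Σ_i v_i` of `C²` short pieces of DIFFERENT lengths, so `S_j(𝐚_u, conj 𝐚_u) = Σ_{i,k} S_j(𝐚_{v_i}, conj 𝐚_{v_k})` needs
the OFF-DIAGONAL rows `S_j(𝐚_u, conj 𝐚_v)` for two `C²` short pieces `u ≠ v` of lengths `θ_u ≠ θ_v`. This file is the
bilinear twin of `Section8ProfileSjCalc` + `Section8ProfileSjMain` (ψ-side profile `u`, anti-side profile `v`):

* `pairProfile γ σ ν θ_v u u′ v v′ z = jetEx γ u u′ z · massEx σ ν θ_v v v′ z`, `pairEngine` (`t = e^{zΛ}`);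
* derivatives, sizes, continuity and integrability on `[0, θ₀]` for any `θ₀ ≤ θ_u, θ_v`; the engine hypotheses for
  `F(t) = Φ(log t/Λ)` on `[1, X+1]` with `log(X+1) < θ₀Λ` (`pairEngine_bounds`); the substitution `∫₁^{e^{bΛ}}F dt/t = Λ∫₀^bΦ`;
* `mainDouble_pair_eq` — the (8.10) collapse for `A_j(n)[u]·B_j(d,r)[v]`;
* `norm_pairProfile_sub_k0_le`, `norm_integral_pairProfile_sub_k0_le` — the jets dictionary with explicit gaps;
* `integral_k0_pair_eq` — `∫₀¹ 𝔧_j(u)𝔪(v̄) = ∫₀^{min(θ_u,θ_v)} 𝔧_j(u)𝔪(v̄)` (the integrand vanishes beyond the shorter piece);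
* `integral_pairProfile_split`.

## References
* Y. Zhang, arXiv:2211.02515v1 (2022), §8 Lemmas 8.2–8.4, (8.10)–(8.12), p.48. [cite: Zhang2022LandauSiegel, §8 (8.10)–(8.12) p.48]
-/

noncomputable section

open Complex Real MeasureTheory Set intervalIntegral Filter Finset
open scoped ComplexConjugate Topology

namespace Literature.NumberTheory.LFunctions.Zhang2022.DipoleRule

open Skeleton KnifeEdge

/-! ### The pair profile -/

/-- **`Φ(z) = jetEx(u)(z)·massEx(v̄)(z)`** — the main-term profile of `A_j(n)[u]·B_j(d,r)[v]/Π(d,r)` in `z = log n/Λ`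
(ψ-side piece `u`, anti-side piece `v` of length `θ_v`), up to the factor `−χ(n)²Λ⁻²L′²`.
[cite: Zhang2022LandauSiegel, §8 (8.11) p.48] -/
def pairProfile (γ σ ν : ℂ) (θv : ℝ) (u u' v v' : ℝ → ℂ) (z : ℝ) : ℂ := jetEx γ u u' z * massEx σ ν θv v v' z

/-- **`F(t) = Φ(log t/Λ)`** — the pair engine profile in the variable `t`. [cite: Zhang2022LandauSiegel, §8 (8.11) p.48] -/
def pairEngine (γ σ ν : ℂ) (θv : ℝ) (u u' v v' : ℝ → ℂ) (Λ : ℝ) (t : ℝ) : ℂ :=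
  pairProfile γ σ ν θv u u' v v' (Real.log t / Λ)

variable {γ σ ν : ℂ} {θu θv θ₀ : ℝ} {u u' u'' v v' v'' : ℝ → ℂ}

/-! ### Derivatives -/

/-- **Product rule for `Φ`:** `Φ′ = jetEx(u)′·massEx(v̄) + jetEx(u)·massEx(v̄)′` at `0 ≤ z < min(θ_u, θ_v)`.
[cite: Zhang2022LandauSiegel, §8 (8.11) p.48] -/
theorem hasDerivAt_pairProfile (hv : ContinuousOn v (Icc 0 θv)) (hdu : ∀ y : ℝ, y < θu → HasDerivAt u (u' y) y)
    (hdu' : ∀ y : ℝ, y < θu → HasDerivAt u' (u'' y) y) (hdv : ∀ y : ℝ, y < θv → HasDerivAt v (v' y) y)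
    (hdv' : ∀ y : ℝ, y < θv → HasDerivAt v' (v'' y) y) {z : ℝ} (hz0 : 0 ≤ z) (hzu : z < θu) (hzv : z < θv) :
    HasDerivAt (pairProfile γ σ ν θv u u' v v')
      ((γ * u' z + u'' z) * massEx σ ν θv v v' z + jetEx γ u u' z * massEx' σ ν v v' v'' z) z := by
  have h := (hasDerivAt_jetEx (γ := γ) hdu hdu' hzu).mul (hasDerivAt_massEx (σ := σ) (ν := ν) hv hdv hdv' hz0 hzv)
  unfold pairProfile
  exact h

/-! ### Sizes (common bounds `B₀, B₁, B₂` for both pieces) -/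

/-- **`‖Φ(z)‖ ≤ J₀K₀`** for `z ∈ [0,θ_u] ∩ [0,θ_v]`, `J₀ = ‖γ‖B₀ + B₁`, `K₀ = B₁ + ‖σ‖B₀ + ‖ν‖B₀θ_v`.
[cite: Zhang2022LandauSiegel, §8 (8.11) p.48] -/
theorem norm_pairProfile_le {z B₀ B₁ : ℝ} (hB0u : ∀ y ∈ Icc 0 θu, ‖u y‖ ≤ B₀) (hB1u : ∀ y ∈ Icc 0 θu, ‖u' y‖ ≤ B₁)
    (hB0v : ∀ y ∈ Icc 0 θv, ‖v y‖ ≤ B₀) (hB1v : ∀ y ∈ Icc 0 θv, ‖v' y‖ ≤ B₁) (hzu : z ∈ Icc 0 θu)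
    (hzv : z ∈ Icc 0 θv) :
    ‖pairProfile γ σ ν θv u u' v v' z‖ ≤ (‖γ‖ * B₀ + B₁) * (B₁ + ‖σ‖ * B₀ + ‖ν‖ * (B₀ * θv)) := by
  unfold pairProfile
  rw [norm_mul]
  have hJ := norm_jetEx_le (γ := γ) (hB0u z hzu) (hB1u z hzu)
  have hK := norm_massEx_le (σ := σ) (ν := ν) hB0v hB1v hzv
  have hJ0 : 0 ≤ ‖γ‖ * B₀ + B₁ := le_trans (norm_nonneg _) hJ
  exact mul_le_mul hJ hK (norm_nonneg _) hJ0

/-- **`‖Φ′(z)‖ ≤ J₁K₀ + J₀K₁`** for `z ∈ [0,θ_u] ∩ [0,θ_v]`, `J₁ = ‖γ‖B₁ + B₂`, `K₁ = B₂ + ‖σ‖B₁ + ‖ν‖B₀`.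
[cite: Zhang2022LandauSiegel, §8 (8.11) p.48] -/
theorem norm_pairProfile'_le {z B₀ B₁ B₂ : ℝ} (hB0u : ∀ y ∈ Icc 0 θu, ‖u y‖ ≤ B₀)
    (hB1u : ∀ y ∈ Icc 0 θu, ‖u' y‖ ≤ B₁) (hB2u : ∀ y ∈ Icc 0 θu, ‖u'' y‖ ≤ B₂)
    (hB0v : ∀ y ∈ Icc 0 θv, ‖v y‖ ≤ B₀) (hB1v : ∀ y ∈ Icc 0 θv, ‖v' y‖ ≤ B₁)
    (hB2v : ∀ y ∈ Icc 0 θv, ‖v'' y‖ ≤ B₂) (hzu : z ∈ Icc 0 θu) (hzv : z ∈ Icc 0 θv) :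
    ‖(γ * u' z + u'' z) * massEx σ ν θv v v' z + jetEx γ u u' z * massEx' σ ν v v' v'' z‖
      ≤ (‖γ‖ * B₁ + B₂) * (B₁ + ‖σ‖ * B₀ + ‖ν‖ * (B₀ * θv))
        + (‖γ‖ * B₀ + B₁) * (B₂ + ‖σ‖ * B₁ + ‖ν‖ * B₀) := by
  have hJ' : ‖γ * u' z + u'' z‖ ≤ ‖γ‖ * B₁ + B₂ := by
    calc ‖γ * u' z + u'' z‖ ≤ ‖γ * u' z‖ + ‖u'' z‖ := norm_add_le _ _
      _ ≤ ‖γ‖ * B₁ + B₂ := by rw [norm_mul]; gcongr; exacts [hB1u z hzu, hB2u z hzu]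
  have hK := norm_massEx_le (σ := σ) (ν := ν) hB0v hB1v hzv
  have hJ := norm_jetEx_le (γ := γ) (hB0u z hzu) (hB1u z hzu)
  have hK' := norm_massEx'_le (σ := σ) (ν := ν) (hB0v z hzv) (hB1v z hzv) (hB2v z hzv)
  have hJ0 : 0 ≤ ‖γ‖ * B₁ + B₂ := le_trans (norm_nonneg _) hJ'
  have hJ00 : 0 ≤ ‖γ‖ * B₀ + B₁ := le_trans (norm_nonneg _) hJ
  calc _ ≤ ‖(γ * u' z + u'' z) * massEx σ ν θv v v' z‖ + ‖jetEx γ u u' z * massEx' σ ν v v' v'' z‖ :=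
        norm_add_le _ _
    _ ≤ _ := by
        rw [norm_mul, norm_mul]
        exact add_le_add (mul_le_mul hJ' hK (norm_nonneg _) hJ0) (mul_le_mul hJ hK' (norm_nonneg _) hJ00)

/-! ### Continuity of `Φ` on `[0,θ₀]`, `θ₀ ≤ θ_u, θ_v` -/

/-- `Φ` is continuous on `[0,θ₀]` whenever `0 ≤ θ₀ ≤ θ_u, θ_v` and `u, u′` (resp. `v, v′`) are continuous on `[0,θ_u]`
(resp. `[0,θ_v]`). [cite: Zhang2022LandauSiegel, §8 (8.11) p.48] -/
theorem continuousOn_pairProfile (hθ0 : 0 ≤ θ₀) (h0u : θ₀ ≤ θu) (h0v : θ₀ ≤ θv)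
    (hu : ContinuousOn u (Icc 0 θu)) (hu' : ContinuousOn u' (Icc 0 θu)) (hv : ContinuousOn v (Icc 0 θv))
    (hv' : ContinuousOn v' (Icc 0 θv)) : ContinuousOn (pairProfile γ σ ν θv u u' v v') (Icc 0 θ₀) := by
  have hθv : 0 ≤ θv := hθ0.trans h0v
  have hsu : Icc 0 θ₀ ⊆ Icc 0 θu := Icc_subset_Icc le_rfl h0u
  have hsv : Icc 0 θ₀ ⊆ Icc 0 θv := Icc_subset_Icc le_rfl h0v
  have hcv : ContinuousOn (fun x => conj (v x)) (Icc 0 θv) := Complex.continuous_conj.comp_continuousOn hv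
  have hcv' : ContinuousOn (fun x => conj (v' x)) (Icc 0 θv) := Complex.continuous_conj.comp_continuousOn hv'
  have hJ : ContinuousOn (jetEx γ u u') (Icc 0 θu) := by
    unfold jetEx; exact (continuousOn_const.mul hu).add hu'
  have hK : ContinuousOn (massEx σ ν θv v v') (Icc 0 θv) := by
    unfold massEx
    exact (hcv'.neg.add (continuousOn_const.mul hcv)).add (continuousOn_const.mul (continuousOn_tailIntegral hv hθv))
  unfold pairProfile
  exact (hJ.mono hsu).mul (hK.mono hsv)

/-- `Φ` is interval-integrable between points of `[0,θ₀]`. [cite: Zhang2022LandauSiegel, §8 (8.11) p.48] -/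
theorem intervalIntegrable_pairProfile (hθ0 : 0 ≤ θ₀) (h0u : θ₀ ≤ θu) (h0v : θ₀ ≤ θv)
    (hu : ContinuousOn u (Icc 0 θu)) (hu' : ContinuousOn u' (Icc 0 θu)) (hv : ContinuousOn v (Icc 0 θv))
    (hv' : ContinuousOn v' (Icc 0 θv)) {a b : ℝ} (ha : a ∈ Icc 0 θ₀) (hb : b ∈ Icc 0 θ₀) :
    IntervalIntegrable (pairProfile γ σ ν θv u u' v v') volume a b := by
  refine ContinuousOn.intervalIntegrable
    ((continuousOn_pairProfile (γ := γ) (σ := σ) (ν := ν) hθ0 h0u h0v hu hu' hv hv').mono ?_)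
  intro x hx
  rw [Set.mem_uIcc] at hx
  rcases hx with h | h
  · exact ⟨ha.1.trans h.1, h.2.trans hb.2⟩
  · exact ⟨hb.1.trans h.1, h.2.trans ha.2⟩

/-! ### The engine profile `F(t) = Φ(log t/Λ)` -/

/-- **`F` is differentiable at `t > 0` with `0 ≤ log t/Λ < θ_u, θ_v`:** `F′(t) = (t⁻¹/Λ)·Φ′(log t/Λ)`.
[cite: Zhang2022LandauSiegel, §8 (8.11) p.48] -/
theorem pairEngine_hasDerivAt (hv : ContinuousOn v (Icc 0 θv)) (hdu : ∀ y : ℝ, y < θu → HasDerivAt u (u' y) y)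
    (hdu' : ∀ y : ℝ, y < θu → HasDerivAt u' (u'' y) y) (hdv : ∀ y : ℝ, y < θv → HasDerivAt v (v' y) y)
    (hdv' : ∀ y : ℝ, y < θv → HasDerivAt v' (v'' y) y) {Λ t : ℝ} (ht : 0 < t)
    (hz0 : 0 ≤ Real.log t / Λ) (hzu : Real.log t / Λ < θu) (hzv : Real.log t / Λ < θv) :
    HasDerivAt (pairEngine γ σ ν θv u u' v v' Λ)
      (((t⁻¹ / Λ : ℝ) : ℂ) *
        ((γ * u' (Real.log t / Λ) + u'' (Real.log t / Λ)) * massEx σ ν θv v v' (Real.log t / Λ)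
          + jetEx γ u u' (Real.log t / Λ) * massEx' σ ν v v' v'' (Real.log t / Λ))) t := by
  have hΦ := hasDerivAt_pairProfile (γ := γ) (σ := σ) (ν := ν) hv hdu hdu' hdv hdv' hz0 hzu hzv
  have hg : HasDerivAt (fun s : ℝ => Real.log s / Λ) (t⁻¹ / Λ) t := (Real.hasDerivAt_log ht.ne').div_const Λ
  have h := hΦ.scomp t hg
  rw [Complex.real_smul] at h
  exact h

/-- **The engine hypotheses for `F` on `[1, X+1]`** (`Λ > 0`, `log(X+1) < θ₀Λ`, `θ₀ ≤ θ_u, θ_v`): differentiable,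
`‖F(t)‖ ≤ J₀K₀`, `‖F′(t)‖ ≤ (J₁K₀ + J₀K₁)/Λ/t`. [cite: Zhang2022LandauSiegel, §8 (8.11) p.48] -/
theorem pairEngine_bounds (h0u : θ₀ ≤ θu) (h0v : θ₀ ≤ θv) (hv : ContinuousOn v (Icc 0 θv))
    (hdu : ∀ y : ℝ, y < θu → HasDerivAt u (u' y) y) (hdu' : ∀ y : ℝ, y < θu → HasDerivAt u' (u'' y) y)
    (hdv : ∀ y : ℝ, y < θv → HasDerivAt v (v' y) y) (hdv' : ∀ y : ℝ, y < θv → HasDerivAt v' (v'' y) y)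
    {B₀ B₁ B₂ : ℝ} (hB0u : ∀ y ∈ Icc 0 θu, ‖u y‖ ≤ B₀) (hB1u : ∀ y ∈ Icc 0 θu, ‖u' y‖ ≤ B₁)
    (hB2u : ∀ y ∈ Icc 0 θu, ‖u'' y‖ ≤ B₂) (hB0v : ∀ y ∈ Icc 0 θv, ‖v y‖ ≤ B₀)
    (hB1v : ∀ y ∈ Icc 0 θv, ‖v' y‖ ≤ B₁) (hB2v : ∀ y ∈ Icc 0 θv, ‖v'' y‖ ≤ B₂) {Λ X : ℝ} (hΛ : 0 < Λ)
    (hXθ : Real.log (X + 1) < θ₀ * Λ) :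
    (∀ t ∈ Icc 1 (X + 1), DifferentiableAt ℝ (pairEngine γ σ ν θv u u' v v' Λ) t) ∧
    (∀ t ∈ Icc 1 (X + 1), ‖pairEngine γ σ ν θv u u' v v' Λ t‖
        ≤ (‖γ‖ * B₀ + B₁) * (B₁ + ‖σ‖ * B₀ + ‖ν‖ * (B₀ * θv))) ∧
    (∀ t ∈ Icc 1 (X + 1), ‖deriv (pairEngine γ σ ν θv u u' v v' Λ) t‖
        ≤ (((‖γ‖ * B₁ + B₂) * (B₁ + ‖σ‖ * B₀ + ‖ν‖ * (B₀ * θv))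
            + (‖γ‖ * B₀ + B₁) * (B₂ + ‖σ‖ * B₁ + ‖ν‖ * B₀)) / Λ) / t) := by
  -- every `t ∈ [1, X+1]` has `0 ≤ z_t < θ₀`
  have hzt : ∀ t ∈ Icc 1 (X + 1), 0 < t ∧ 0 ≤ Real.log t / Λ ∧ Real.log t / Λ < θ₀ := by
    intro t ht
    have ht0 : 0 < t := by linarith [ht.1]
    refine ⟨ht0, div_nonneg (Real.log_nonneg ht.1) hΛ.le, ?_⟩
    rw [div_lt_iff₀ hΛ]
    exact lt_of_le_of_lt (Real.log_le_log ht0 ht.2) hXθ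
  refine ⟨fun t ht => ?_, fun t ht => ?_, fun t ht => ?_⟩
  · obtain ⟨ht0, hz0, hz⟩ := hzt t ht
    exact (pairEngine_hasDerivAt (γ := γ) (σ := σ) (ν := ν) hv hdu hdu' hdv hdv' ht0 hz0
      (lt_of_lt_of_le hz h0u) (lt_of_lt_of_le hz h0v)).differentiableAt
  · obtain ⟨ht0, hz0, hz⟩ := hzt t ht
    exact norm_pairProfile_le (γ := γ) (σ := σ) (ν := ν) hB0u hB1u hB0v hB1v ⟨hz0, (lt_of_lt_of_le hz h0u).le⟩
      ⟨hz0, (lt_of_lt_of_le hz h0v).le⟩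
  · obtain ⟨ht0, hz0, hz⟩ := hzt t ht
    rw [(pairEngine_hasDerivAt (γ := γ) (σ := σ) (ν := ν) hv hdu hdu' hdv hdv' ht0 hz0
      (lt_of_lt_of_le hz h0u) (lt_of_lt_of_le hz h0v)).deriv, norm_mul,
      Complex.norm_real, Real.norm_of_nonneg (by positivity)]
    have hΦ' := norm_pairProfile'_le (γ := γ) (σ := σ) (ν := ν) hB0u hB1u hB2u hB0v hB1v hB2v
      ⟨hz0, (lt_of_lt_of_le hz h0u).le⟩ ⟨hz0, (lt_of_lt_of_le hz h0v).le⟩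
    calc t⁻¹ / Λ * _ ≤ t⁻¹ / Λ * (((‖γ‖ * B₁ + B₂) * (B₁ + ‖σ‖ * B₀ + ‖ν‖ * (B₀ * θv))
            + (‖γ‖ * B₀ + B₁) * (B₂ + ‖σ‖ * B₁ + ‖ν‖ * B₀))) :=
          mul_le_mul_of_nonneg_left hΦ' (by positivity)
      _ = _ := by field_simp

/-! ### The substitution `t = e^{zΛ}` -/

/-- **`∫₁^{e^{bΛ}} F(t) dt/t = Λ·∫₀^b Φ(z) dz`** (`Λ > 0`). [cite: Zhang2022LandauSiegel, §8 (8.11)–(8.12) p.48] -/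
theorem integral_pairEngine_eq {Λ : ℝ} (hΛ : 0 < Λ) (b : ℝ) :
    ∫ t in (1:ℝ)..Real.exp (b * Λ), pairEngine γ σ ν θv u u' v v' Λ t / t
      = (Λ : ℂ) * ∫ z in (0:ℝ)..b, pairProfile γ σ ν θv u u' v v' z := by
  have h := integral_comp_exp_mul hΛ.le (pairEngine γ σ ν θv u u' v v' Λ) (a := 0) (b := b)
  rw [mul_zero, Real.exp_zero, mul_comm Λ b] at h
  rw [← h]
  congr 1
  refine intervalIntegral.integral_congr fun z _ => ?_
  simp only [pairEngine]
  rw [mul_comm Λ z, Real.log_exp, mul_div_cancel_right₀ _ hΛ.ne']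

/-! ### «Substituting `n = dr`»: the main double sum collapses by (8.10) -/

/-- On the antidiagonal of `n`, `A_j(n)[u]·B_j(d,r)[v] = Π(d,r)·(−χ(n)²Λ⁻²L′²·Φ(z_n))`. [cite: Zhang2022LandauSiegel, §8 p.48] -/
theorem psiMain_mul_antiMain_pair_eq (c' : ℝ) {D : ℕ} [NeZero D] (χ : DirichletCharacter ℂ D) (j : ℕ)
    (u u' v v' : ℝ → ℂ) (θv : ℝ) {n : ℕ} {p : ℕ × ℕ} (hp : p ∈ Nat.divisorsAntidiagonal n) :
    psiMain c' D χ j u u' n * antiMain c' D χ j v v' θv p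
      = PiW χ p.1 p.2 *
        (-(χ (n : ZMod D) ^ 2 * ((Real.log D ^ 9 : ℝ) : ℂ)⁻¹ ^ 2 * deriv χ.LFunction 1 ^ 2 *
          pairEngine (betaJ c' D j * Real.log D ^ 9) (sigmaJ c' D j) (nuJ c' D j) θv u u' v v'
            (Real.log D ^ 9) n)) := by
  rw [Nat.mem_divisorsAntidiagonal] at hp
  unfold psiMain antiMain pairEngine pairProfile
  rw [hp.1]
  ring

/-- **THE COLLAPSE BY (8.10), bilinear:** for a quadratic `χ` and any cut `K`,
`Σ_{1≤n<K} Σ_{dr=n} w_j(d,r)·A_j(n)[u]B_j(d,r)[v] = −(Λ⁻²·L′(1,χ)²·Σ_{1≤n<K} |χ(n)|λ₀ⱼ(n)/φ(n)·F(n))`, `F = pairEngine`.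
[cite: Zhang2022LandauSiegel, §8 (8.10) and display after it, p.48] -/
theorem mainDouble_pair_eq (c' : ℝ) {D : ℕ} [NeZero D] (χ : DirichletCharacter ℂ D) (hq : χ.IsQuadratic) (j : ℕ)
    (u u' v v' : ℝ → ℂ) (θv : ℝ) (K : ℕ) :
    ∑ n ∈ Finset.Ico 1 K, ∑ p ∈ Nat.divisorsAntidiagonal n,
        sjWeight c' χ j p * (psiMain c' D χ j u u' n * antiMain c' D χ j v v' θv p)
      = -(((Real.log D ^ 9 : ℝ) : ℂ)⁻¹ ^ 2 * deriv χ.LFunction 1 ^ 2 *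
          ∑ n ∈ Finset.Ico 1 K, (‖χ (n : ZMod D)‖ : ℂ) * lamZero c' D j n / (Nat.totient n : ℂ) *
            pairEngine (betaJ c' D j * Real.log D ^ 9) (sigmaJ c' D j) (nuJ c' D j) θv u u' v v'
              (Real.log D ^ 9) n) := by
  have h810 := Section8FrontEnd810.eq810_holds D χ hq
  rw [Finset.mul_sum, ← Finset.sum_neg_distrib]
  refine Finset.sum_congr rfl fun n hn => ?_
  rw [Finset.mem_Ico] at hn
  have hn0 : n ≠ 0 := by omega
  set G : ℂ := -(χ (n : ZMod D) ^ 2 * ((Real.log D ^ 9 : ℝ) : ℂ)⁻¹ ^ 2 * deriv χ.LFunction 1 ^ 2 *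
    pairEngine (betaJ c' D j * Real.log D ^ 9) (sigmaJ c' D j) (nuJ c' D j) θv u u' v v' (Real.log D ^ 9) n)
    with hG
  have hterm : ∀ p ∈ Nat.divisorsAntidiagonal n,
      sjWeight c' χ j p * (psiMain c' D χ j u u' n * antiMain c' D χ j v v' θv p)
        = ((ArithmeticFunction.moebius p.2).natAbs : ℂ) * (‖χ ((p.1 * p.2 : ℕ) : ZMod D)‖ : ℂ) /
            (((p.1 * p.2 : ℕ) : ℂ) * (Nat.totient p.2 : ℂ)) * lamZero c' D j (p.1 * p.2) * PiW χ p.1 p.2 * G := by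
    intro p hp
    rw [psiMain_mul_antiMain_pair_eq c' χ j u u' v v' θv hp, ← hG]
    unfold sjWeight
    ring
  rw [Finset.sum_congr rfl hterm, Section8FrontEnd810.sum_antidiagonal_weight χ c' j h810 hn0 G, hG]
  have hsq := norm_mul_sq_of_isQuadratic hq (n : ZMod D)
  calc (‖χ (n : ZMod D)‖ : ℂ) * lamZero c' D j n / (Nat.totient n : ℂ) *
        -(χ (n : ZMod D) ^ 2 * ((Real.log D ^ 9 : ℝ) : ℂ)⁻¹ ^ 2 * deriv χ.LFunction 1 ^ 2 *
          pairEngine (betaJ c' D j * Real.log D ^ 9) (sigmaJ c' D j) (nuJ c' D j) θv u u' v v' (Real.log D ^ 9) n)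
      = -(((‖χ (n : ZMod D)‖ : ℂ) * χ (n : ZMod D) ^ 2) * lamZero c' D j n / (Nat.totient n : ℂ) *
          (((Real.log D ^ 9 : ℝ) : ℂ)⁻¹ ^ 2 * deriv χ.LFunction 1 ^ 2 *
          pairEngine (betaJ c' D j * Real.log D ^ 9) (sigmaJ c' D j) (nuJ c' D j) θv u u' v v'
            (Real.log D ^ 9) n)) := by
        ring
    _ = _ := by rw [hsq]; ring

/-! ### The dictionary `Φ ↔ 𝔧_j(u)·𝔪(bS j, bN j; v̄)` -/

/-- **Pointwise gap `Φ − 𝔧_j(u)𝔪(v̄)` on `[0,θ_u] ∩ [0,θ_v]`:** with `‖jetEx(u) − 𝔧_j(u)‖ ≤ ε_J` on `[0,θ_u]`,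
`‖σ − iπs‖ ≤ ε_σ`, `‖ν + π²N‖ ≤ ε_ν` and the common profile bounds `B₀, B₁`:
`‖Φ(z) − 𝔧_j(u;z)𝔪(v̄)(z)‖ ≤ ε_J(B₁ + ‖σ‖B₀ + ‖ν‖B₀θ_v) + (B₁ + πjB₀)(ε_σB₀ + ε_νB₀θ_v)`.
[cite: Zhang2022LandauSiegel, §8 Lemmas 8.2/8.4; §2 (2.13)] -/
theorem norm_pairProfile_sub_k0_le {j : ℕ} {s N : ℝ} (hv : ContinuousOn v (Icc 0 θv))
    (hvvan : ∀ y : ℝ, θv ≤ y → v y = 0) (hθv0 : 0 ≤ θv) (hθv1 : θv ≤ 1) {B₀ B₁ εJ εσ εν : ℝ}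
    (hB0u : ∀ y ∈ Icc 0 θu, ‖u y‖ ≤ B₀) (hB1u : ∀ y ∈ Icc 0 θu, ‖u' y‖ ≤ B₁)
    (hB0v : ∀ y ∈ Icc 0 θv, ‖v y‖ ≤ B₀) (hB1v : ∀ y ∈ Icc 0 θv, ‖v' y‖ ≤ B₁)
    (hJ : ∀ y ∈ Icc 0 θu, ‖jetEx γ u u' y - k0jet j u u' y‖ ≤ εJ) (hσ : ‖σ - I * π * ((s : ℝ) : ℂ)‖ ≤ εσ)
    (hν : ‖ν + (π : ℂ) ^ 2 * ((N : ℝ) : ℂ)‖ ≤ εν) {z : ℝ} (hzu : z ∈ Icc 0 θu) (hzv : z ∈ Icc 0 θv) :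
    ‖pairProfile γ σ ν θv u u' v v' z - k0jet j u u' z * k0mass s N (fun t => conj (v t)) (fun t => conj (v' t)) z‖
      ≤ εJ * (B₁ + ‖σ‖ * B₀ + ‖ν‖ * (B₀ * θv)) + (B₁ + π * j * B₀) * (εσ * B₀ + εν * (B₀ * θv)) := by
  have hB00 : 0 ≤ B₀ := (norm_nonneg _).trans (hB0v z hzv)
  have hεσ : 0 ≤ εσ := (norm_nonneg _).trans hσ
  have hεν : 0 ≤ εν := (norm_nonneg _).trans hν
  have hgap := massEx_sub_k0mass (σ := σ) (ν := ν) (s := s) (N := N) (u' := v') hv hvvan hθv0 hθv1 hzv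
  set K := massEx σ ν θv v v' z with hK
  set Km := k0mass s N (fun t => conj (v t)) (fun t => conj (v' t)) z with hKm
  set J := jetEx γ u u' z with hJd
  set Jk := k0jet j u u' z with hJk
  have e : J * K - Jk * Km = (J - Jk) * K + Jk * (K - Km) := by ring
  have hKn : ‖K‖ ≤ B₁ + ‖σ‖ * B₀ + ‖ν‖ * (B₀ * θv) := norm_massEx_le (σ := σ) (ν := ν) hB0v hB1v hzv
  have hJkn : ‖Jk‖ ≤ B₁ + π * j * B₀ := norm_k0jet_le (hB0u z hzu) (hB1u z hzu)
  have hgapn : ‖K - Km‖ ≤ εσ * B₀ + εν * (B₀ * θv) := by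
    rw [hgap]
    have hint : ‖∫ y in z..θv, conj (v y)‖ ≤ B₀ * θv := by
      have h1 : ‖∫ y in z..θv, conj (v y)‖ ≤ B₀ * |θv - z| := by
        refine intervalIntegral.norm_integral_le_of_norm_le_const fun y hy => ?_
        rw [Set.uIoc_of_le hzv.2] at hy
        rw [Complex.norm_conj]
        exact hB0v y ⟨hzv.1.trans hy.1.le, hy.2⟩
      rw [abs_of_nonneg (by linarith [hzv.2])] at h1
      exact h1.trans (by nlinarith [hzv.1])
    calc ‖(σ - I * π * ((s : ℝ) : ℂ)) * conj (v z) + (ν + (π : ℂ) ^ 2 * ((N : ℝ) : ℂ)) * ∫ y in z..θv, conj (v y)‖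
        ≤ ‖(σ - I * π * ((s : ℝ) : ℂ)) * conj (v z)‖ + ‖(ν + (π : ℂ) ^ 2 * ((N : ℝ) : ℂ)) * ∫ y in z..θv, conj (v y)‖ :=
          norm_add_le _ _
      _ ≤ εσ * B₀ + εν * (B₀ * θv) := by
          rw [norm_mul, norm_mul, Complex.norm_conj]
          gcongr
          exact hB0v z hzv
  have hJk0 : 0 ≤ B₁ + π * j * B₀ := (norm_nonneg _).trans hJkn
  unfold pairProfile
  rw [← hJd, ← hK, e]
  calc ‖(J - Jk) * K + Jk * (K - Km)‖ ≤ ‖(J - Jk) * K‖ + ‖Jk * (K - Km)‖ := norm_add_le _ _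
    _ = ‖J - Jk‖ * ‖K‖ + ‖Jk‖ * ‖K - Km‖ := by rw [norm_mul, norm_mul]
    _ ≤ εJ * (B₁ + ‖σ‖ * B₀ + ‖ν‖ * (B₀ * θv)) + (B₁ + π * j * B₀) * (εσ * B₀ + εν * (B₀ * θv)) := by
        gcongr
        · exact (norm_nonneg _).trans (hJ z hzu)
        · exact hJ z hzu

/-- **Integrated gap over `[0,θ₀]`, `0 ≤ θ₀ ≤ θ_u, θ_v`:** `‖∫₀^{θ₀}(Φ − 𝔧_j(u)𝔪(v̄))‖ ≤ (ε_JK₀ + (B₁+πjB₀)(ε_σB₀ + ε_νB₀θ_v))·θ₀`.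
[cite: Zhang2022LandauSiegel, §8 (8.11)–(8.12); §2 (2.13)] -/
theorem norm_integral_pairProfile_sub_k0_le {j : ℕ} {s N : ℝ} (hθ0 : 0 ≤ θ₀) (h0u : θ₀ ≤ θu) (h0v : θ₀ ≤ θv)
    (hv : ContinuousOn v (Icc 0 θv)) (hvvan : ∀ y : ℝ, θv ≤ y → v y = 0) (hθv1 : θv ≤ 1)
    {B₀ B₁ εJ εσ εν : ℝ} (hB0u : ∀ y ∈ Icc 0 θu, ‖u y‖ ≤ B₀) (hB1u : ∀ y ∈ Icc 0 θu, ‖u' y‖ ≤ B₁)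
    (hB0v : ∀ y ∈ Icc 0 θv, ‖v y‖ ≤ B₀) (hB1v : ∀ y ∈ Icc 0 θv, ‖v' y‖ ≤ B₁)
    (hJ : ∀ y ∈ Icc 0 θu, ‖jetEx γ u u' y - k0jet j u u' y‖ ≤ εJ) (hσ : ‖σ - I * π * ((s : ℝ) : ℂ)‖ ≤ εσ)
    (hν : ‖ν + (π : ℂ) ^ 2 * ((N : ℝ) : ℂ)‖ ≤ εν) :
    ‖∫ z in (0:ℝ)..θ₀, (pairProfile γ σ ν θv u u' v v' z
        - k0jet j u u' z * k0mass s N (fun t => conj (v t)) (fun t => conj (v' t)) z)‖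
      ≤ (εJ * (B₁ + ‖σ‖ * B₀ + ‖ν‖ * (B₀ * θv)) + (B₁ + π * j * B₀) * (εσ * B₀ + εν * (B₀ * θv))) * θ₀ := by
  have h := intervalIntegral.norm_integral_le_of_norm_le_const (a := (0:ℝ)) (b := θ₀)
    (f := fun z => pairProfile γ σ ν θv u u' v v' z
      - k0jet j u u' z * k0mass s N (fun t => conj (v t)) (fun t => conj (v' t)) z)
    (C := εJ * (B₁ + ‖σ‖ * B₀ + ‖ν‖ * (B₀ * θv)) + (B₁ + π * j * B₀) * (εσ * B₀ + εν * (B₀ * θv))) ?_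
  · rwa [sub_zero, abs_of_nonneg hθ0] at h
  · intro z hz
    rw [Set.uIoc_of_le hθ0] at hz
    exact norm_pairProfile_sub_k0_le hv hvvan (hθ0.trans h0v) hθv1 hB0u hB1u hB0v hB1v hJ hσ hν
      ⟨hz.1.le, hz.2.trans h0u⟩ ⟨hz.1.le, hz.2.trans h0v⟩

/-- **`∫₀¹ 𝔧_j(u)𝔪(v̄) = ∫₀^{θ₀} 𝔧_j(u)𝔪(v̄)` for two short pieces, `θ₀ = min(θ_u, θ_v)`:** the jet `𝔧_j(u;z)` vanishes for
`z > θ_u` (`u = 0` on `[θ_u,∞)`, `u′ = 0` on `(θ_u,∞)`) and the mass rule `𝔪(v̄)(z)` vanishes for `z > θ_v`.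
[cite: Zhang2022LandauSiegel, §7 (7.2); Prop 7.1 pp.44–50] -/
theorem integral_k0_pair_eq {j : ℕ} {s N : ℝ} (hmin : θ₀ = min θu θv) (hθ0 : 0 ≤ θ₀) (hθu1 : θu ≤ 1) (hθv1 : θv ≤ 1)
    (hu : ContinuousOn u (Icc 0 θu)) (hu' : ContinuousOn u' (Icc 0 θu)) (hv : ContinuousOn v (Icc 0 θv))
    (hv' : ContinuousOn v' (Icc 0 θv)) (huvan : ∀ y : ℝ, θu ≤ y → u y = 0) (huvan' : ∀ y : ℝ, θu < y → u' y = 0)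
    (hvvan : ∀ y : ℝ, θv ≤ y → v y = 0) (hvvan' : ∀ y : ℝ, θv < y → v' y = 0) :
    (∫ z in (0:ℝ)..1, k0jet j u u' z * k0mass s N (fun t => conj (v t)) (fun t => conj (v' t)) z)
      = ∫ z in (0:ℝ)..θ₀, k0jet j u u' z * k0mass s N (fun t => conj (v t)) (fun t => conj (v' t)) z := by
  have h0u : θ₀ ≤ θu := hmin ▸ min_le_left _ _
  have h0v : θ₀ ≤ θv := hmin ▸ min_le_right _ _
  have hθ01 : θ₀ ≤ 1 := h0u.trans hθu1
  set f : ℝ → ℂ := fun z => k0jet j u u' z * k0mass s N (fun t => conj (v t)) (fun t => conj (v' t)) z with hf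
  have hcu1 : ContinuousOn u (Icc 0 1) := continuousOn_Icc_one_of_short hu huvan
  have hcv1 : ContinuousOn (fun y => conj (v y)) (Icc 0 1) :=
    Complex.continuous_conj.comp_continuousOn (continuousOn_Icc_one_of_short hv hvvan)
  have htail : ContinuousOn (fun z => ∫ t in z..1, conj (v t)) (Icc 0 1) := by
    have hint : IntegrableOn (fun x => conj (v x)) (Set.uIcc 0 1) volume := by
      rw [Set.uIcc_of_le zero_le_one]
      exact hcv1.integrableOn_compact isCompact_Icc
    have h := intervalIntegral.continuousOn_primitive_interval_left hint
    rwa [Set.uIcc_of_le zero_le_one] at h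
  -- on `(θ₀, 1]` the integrand vanishes: `z > θ_u` kills the jet, `z > θ_v` kills the mass rule
  have hzero : ∀ z : ℝ, θ₀ < z → z ≤ 1 → f z = 0 := by
    intro z hz hz1
    rcases le_total θu θv with h | h
    · have hzu : θu < z := by rw [hmin, min_eq_left h] at hz; exact hz
      simp only [hf, k0jet, huvan z hzu.le, huvan' z hzu, mul_zero, add_zero, zero_mul]
    · have hzv : θv < z := by rw [hmin, min_eq_right h] at hz; exact hz
      have htl : (∫ t in z..1, conj (v t)) = 0 := by
        rw [← intervalIntegral.integral_zero (a := z) (b := (1:ℝ))]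
        refine intervalIntegral.integral_congr fun y hy => ?_
        rw [Set.uIcc_of_le hz1] at hy
        simp [hvvan y (hzv.le.trans hy.1)]
      simp only [hf, k0mass, htl, hvvan z hzv.le, hvvan' z hzv, map_zero, mul_zero, sub_zero, add_zero]
  have h2 : (∫ z in θ₀..1, f z) = 0 := by
    rw [← intervalIntegral.integral_zero (a := θ₀) (b := (1:ℝ))]
    refine intervalIntegral.integral_congr_ae (Eventually.of_forall fun z hz => ?_)
    rw [Set.uIoc_of_le hθ01] at hz
    exact hzero z hz.1 hz.2
  have hK0 : ContinuousOn (fun z => k0mass s N (fun t => conj (v t)) (fun t => conj (v' t)) z) (Icc 0 θv) := by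
    unfold k0mass
    refine ((continuousOn_const.mul (htail.mono (Icc_subset_Icc le_rfl hθv1))).add
      (continuousOn_const.mul (Complex.continuous_conj.comp_continuousOn hv))).sub
      (Complex.continuous_conj.comp_continuousOn hv')
  have hJ0 : ContinuousOn (k0jet j u u') (Icc 0 θu) := by
    unfold k0jet; exact hu'.add (continuousOn_const.mul hu)
  have hi1 : IntervalIntegrable f volume 0 θ₀ :=
    ContinuousOn.intervalIntegrable (by
      rw [Set.uIcc_of_le hθ0]
      exact (hJ0.mono (Icc_subset_Icc le_rfl h0u)).mul (hK0.mono (Icc_subset_Icc le_rfl h0v)))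
  have hi2 : IntervalIntegrable f volume θ₀ 1 := by
    refine (intervalIntegrable_const (c := (0:ℂ)) (μ := volume) (a := θ₀) (b := 1)).congr ?_
    rw [Set.uIoc_of_le hθ01]
    exact fun z hz => (hzero z hz.1 hz.2).symm
  rw [← intervalIntegral.integral_add_adjacent_intervals hi1 hi2, h2, add_zero]

/-- **Splitting the main integral at `b ∈ [0,θ₀]`:** `∫₀^b Φ = ∫₀^{θ₀} Φ − ∫_b^{θ₀} Φ` and `‖∫_b^{θ₀} Φ‖ ≤ (θ₀ − b)·J₀K₀`.
[cite: Zhang2022LandauSiegel, §8 (8.11) p.48] -/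
theorem integral_pairProfile_split (hθ0 : 0 ≤ θ₀) (h0u : θ₀ ≤ θu) (h0v : θ₀ ≤ θv) (hu : ContinuousOn u (Icc 0 θu))
    (hu' : ContinuousOn u' (Icc 0 θu)) (hv : ContinuousOn v (Icc 0 θv)) (hv' : ContinuousOn v' (Icc 0 θv))
    {B₀ B₁ : ℝ} (hB0u : ∀ y ∈ Icc 0 θu, ‖u y‖ ≤ B₀) (hB1u : ∀ y ∈ Icc 0 θu, ‖u' y‖ ≤ B₁)
    (hB0v : ∀ y ∈ Icc 0 θv, ‖v y‖ ≤ B₀) (hB1v : ∀ y ∈ Icc 0 θv, ‖v' y‖ ≤ B₁) {b : ℝ} (hb : b ∈ Icc 0 θ₀) :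
    (∫ z in (0:ℝ)..b, pairProfile γ σ ν θv u u' v v' z)
        = (∫ z in (0:ℝ)..θ₀, pairProfile γ σ ν θv u u' v v' z) - ∫ z in b..θ₀, pairProfile γ σ ν θv u u' v v' z ∧
      ‖∫ z in b..θ₀, pairProfile γ σ ν θv u u' v v' z‖
        ≤ (θ₀ - b) * ((‖γ‖ * B₀ + B₁) * (B₁ + ‖σ‖ * B₀ + ‖ν‖ * (B₀ * θv))) := by
  have h0 : (0:ℝ) ∈ Icc 0 θ₀ := ⟨le_rfl, hθ0⟩
  have hθ : θ₀ ∈ Icc 0 θ₀ := ⟨hθ0, le_rfl⟩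
  have i1 := intervalIntegrable_pairProfile (γ := γ) (σ := σ) (ν := ν) hθ0 h0u h0v hu hu' hv hv' h0 hb
  have i2 := intervalIntegrable_pairProfile (γ := γ) (σ := σ) (ν := ν) hθ0 h0u h0v hu hu' hv hv' hb hθ
  constructor
  · rw [← intervalIntegral.integral_add_adjacent_intervals i1 i2]; ring
  · have h := intervalIntegral.norm_integral_le_of_norm_le_const (a := b) (b := θ₀)
      (f := pairProfile γ σ ν θv u u' v v') (C := (‖γ‖ * B₀ + B₁) * (B₁ + ‖σ‖ * B₀ + ‖ν‖ * (B₀ * θv))) ?_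
    · rw [abs_of_nonneg (by linarith [hb.2])] at h
      linarith
    · intro z hz
      rw [Set.uIoc_of_le hb.2] at hz
      exact norm_pairProfile_le (γ := γ) (σ := σ) (ν := ν) hB0u hB1u hB0v hB1v
        ⟨hb.1.trans hz.1.le, hz.2.trans h0u⟩ ⟨hb.1.trans hz.1.le, hz.2.trans h0v⟩

end Literature.NumberTheory.LFunctions.Zhang2022.DipoleRule

end
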